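import Summits.BirchSwinnertonDyer.Rank1Residual.Additive.ReductionInvariantTwistClass
import Summits.BirchSwinnertonDyer.Rank1Residual.Additive.CyclotomicKummerUnit
import Summits.BirchSwinnertonDyer.Rank1Residual.Additive.GordTraceFormFour
import HarnessLib

/-!
# The EXPLICIT SPECIAL FIBRE of a (G)-pair over `ℚ(ζ_p)`: `c₄(Ẽ) = t⁴·(c₄/(−p)^v)`,
# `c₆(Ẽ) = t⁶·(c₆/(−p)^v)` (gen 34's LAW 4 as a theorem)

HONEST FRAMING (cell `b2b-bsdres`, run/shared/lean/b2b/bsd-rank1-residual/, verbatim in every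
file): the goal of the cell is to DELETE the COMBINATION-SHAPED residual classes of the
Birch–Swinnerton-Dyer formula for ALL analytic-rank `≤ 1` elliptic curves over `ℚ` — "full BSD
formula for every rank `≤ 1` curve in class `C`" assembled STRICTLY from published theorems — so
that the rank-`≤ 1` remainder becomes exactly the CONSTRUCTION-SHAPED classes, which are TYPED
(missing-input `Prop`s), NOT attempted. This is not "finishing BSD". Sub-cell `additive-p2`
(X3♯(G-ord) / X4♯(G-ord)), generation 36, part 3: research route; no claim beyond the stated
classes; theorems only, no definition, no named fact, nothing booked, no label moved.

## What is proved

Let `W` be a globally minimal model of `E/ℚ`, `p ≥ 5`, `K` a `p`-th cyclotomic field, `𝔭` the place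
of `K` above `p` (`k_𝔭 = 𝔽_p`), and suppose `E_K` has good reduction at `𝔭` (this is Delbourgo's (G)
at its top field; every (G)-field lies in `K`). Write the free invariant of the Kodaira type as
`n·(−p)^v` with `p ∤ n` (`n, v` are Cremona integers: `v = v_p(c₄)` resp. `v_p(c₆)`,
`n = c₄/(−p)^v` resp. `c₆/(−p)^v`; existence: `exists_c₄_eq_mul_neg_pow_of_semistabilityIndex_eq_four`,
`exists_c₆_eq_mul_neg_pow_of_three_dvd_semistabilityIndex`).

* **`exists_reductionAt_c₄_eq_pow_four_mul_intCast_of_semistabilityIndex_eq_four`** (defect `4`: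
  Kodaira `III`, `III*`; `4 ∣ p − 1`): `c₄(E) = n·(−p)^v` ⟹ **`c₄(Ẽ_𝔭) = t⁴·n̄`** for some `t ∈ 𝔽_p^×`
  — the special fibre is `y² = x³ + αx`, `α = −27n̄` up to `(𝔽_p^×)⁴` (gen 34's LAW 4, `α = −27c₄/(−p)^v`);
* **`exists_reductionAt_c₆_eq_pow_six_mul_intCast_of_three_dvd_semistabilityIndex`** (defect `3`/`6`:
  `II`, `IV`, `IV*`, `II*`; `3 ∣ p − 1`): `c₆(E) = n·(−p)^v` ⟹ **`c₆(Ẽ_𝔭) = t⁶·n̄`**, `t ∈ 𝔽_p^×` — the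
  special fibre is `y² = x³ + β`, `β = −54n̄` up to `(𝔽_p^×)⁶` (LAW 4, `β = −54c₆/(−p)^v`).

Mechanism: `(ζ − 1)^{p−1} = −p·η`, `η ≡ 1` (part 2), so `η^v·c₄(E) = ((ζ − 1)^{(p−1)v/4})⁴·n`; the
chosen minimal model at `𝔭` has `c₄ = u⁻⁴c₄(E)` a unit (`j̃ = 1728`, gen 11), hence
`c₄(Ẽ_𝔭) = (s/u)⁴·n̄` with `s/u ∈ O_𝔭^×` (part 1; Silverman VII.1.3(b)). No model is constructed, no
Tate algorithm is run. Census (EVIDENCE, gen 34 `special_fibre_reading.py`, zero compute): 599/599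
defect-`3`/`4`/`6` (G-ord) rows `N < 2·10⁴` have `a_𝔭 = p + 1 − #{y² = x³ + αx}` / `#{y² = x³ + β}`.

References: J. H. Silverman, *AEC* VII.1.3(b), VII.5; *ATAEC* IV.9 Table 4.1; L. C. Washington,
GTM 83, Lemma 1.4; D. Delbourgo, Compositio Math. 113 (1998) §1.5 (G), p. 133 (the reduction over
the (G)-field).
-/

noncomputable section

open scoped Classical NumberField

open WeierstrassCurve IsDedekindDomain IsDedekindDomain.HeightOneSpectrum NumberField IsLocalRing
  Literature.NumberTheory.EllipticCurves Literature.NumberTheory.EllipticCurves.Rank1Residual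

namespace Summit.BirchSwinnertonDyer.Rank1Residual.Additive

section Cyclotomic

variable (W : WeierstrassCurve ℚ) [W.IsElliptic] [W.IsGloballyMinimal] (p : ℕ) [hp : Fact p.Prime]
  {K : Type} [Field K] [NumberField K] [IsCyclotomicExtension {p} ℚ K]

omit [IsCyclotomicExtension {p} ℚ K] in
/-- Transport of a factorisation `η^v · x = s^e · n` from `K` to the completion `K_𝔭`, in the shape
consumed by part 1 (`η ∈ 𝓞 K` through `O_𝔭`, `n ∈ ℤ` through `O_𝔭`). [folklore] -/
theorem algebraMap_pow_mul_eq_of_eq (𝔭 : HeightOneSpectrum (𝓞 K)) {η : 𝓞 K} {x s : K} {n : ℤ}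
    {v e : ℕ} (h : (η : K) ^ v * x = s ^ e * (n : K)) :
    algebraMap (𝔭.adicCompletionIntegers K) (𝔭.adicCompletion K)
        ((algebraMap (𝓞 K) (𝔭.adicCompletionIntegers K) η) ^ v) * algebraMap K (𝔭.adicCompletion K) x =
      (algebraMap K (𝔭.adicCompletion K) s) ^ e *
        algebraMap (𝔭.adicCompletionIntegers K) (𝔭.adicCompletion K) (n : 𝔭.adicCompletionIntegers K) := by
  have hη : algebraMap (𝔭.adicCompletionIntegers K) (𝔭.adicCompletion K)
      (algebraMap (𝓞 K) (𝔭.adicCompletionIntegers K) η) = algebraMap K (𝔭.adicCompletion K) (η : K) := by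
    change ((algebraMap (𝓞 K) (𝔭.adicCompletionIntegers K) η : 𝔭.adicCompletionIntegers K) :
      𝔭.adicCompletion K) = _
    rw [algebraMap_adicCompletionIntegers_apply, algebraMap_adicCompletion]
    rfl
  rw [map_pow, hη, map_intCast, ← map_intCast (algebraMap K (𝔭.adicCompletion K)) n, ← map_pow,
    ← map_mul, h, map_mul, map_pow]

omit [IsCyclotomicExtension {p} ℚ K] in
/-- `(n : k_𝔭) ≠ 0` for `p ∤ n` at a place of norm `p`. [folklore] -/
theorem intCast_residueField_ne_zero (𝔭 : HeightOneSpectrum (𝓞 K)) (hN : Ideal.absNorm 𝔭.asIdeal = p)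
    {n : ℤ} (hpn : ¬ (p : ℤ) ∣ n) :
    (n : ResidueField (𝔭.adicCompletionIntegers K)) ≠ 0 := by
  haveI := Fintype.ofFinite (ResidueField (𝔭.adicCompletionIntegers K))
  obtain ⟨hchar, -⟩ := SpecialJ.ringChar_eq_of_natCard_eq
    (k := ResidueField (𝔭.adicCompletionIntegers K)) hp.out
    (natCard_residueField_adicCompletionIntegers_eq_of_absNorm 𝔭 hN)
  haveI : CharP (ResidueField (𝔭.adicCompletionIntegers K)) p := hchar ▸ ringChar.charP _
  rw [Ne, CharP.intCast_eq_zero_iff _ p]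
  exact hpn

/-- **THE EXPLICIT SPECIAL FIBRE ON DEFECT `4` (gen 34's LAW 4, `j̃ = 1728` half).** Let `W` be a
globally minimal model of `E/ℚ`, `p ≥ 5` with `4 ∣ p − 1`, `e_E(p) = 4` (Kodaira `III`/`III*`), `K` a
`p`-th cyclotomic field and `𝔭 ∋ p` a place of `K` at which `E_K` has good reduction. If
`c₄(E) = n·(−p)^v` with `p ∤ n` (`v = v_p(c₄) ∈ {1, 3}`, `n = c₄/(−p)^v ∈ ℤ`), then
**`c₄(Ẽ_𝔭) = t⁴·n̄` for some `t ∈ k_𝔭 = 𝔽_p`, `t ≠ 0`**: the special fibre is `y² = x³ − 27n·τ⁴x`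
over `𝔽_p`, i.e. LAW 4's `α = −27c₄/(−p)^{v_p(c₄)}` up to fourth powers (census 265/265).
[cite: SilvermanAEC2009, Prop. VII.1.3(b), p. 186] -/
theorem exists_reductionAt_c₄_eq_pow_four_mul_intCast_of_semistabilityIndex_eq_four (hp5 : 5 ≤ p)
    (h4 : 4 ∣ p - 1) (he : semistabilityIndex W p = 4) {𝔭 : HeightOneSpectrum (𝓞 K)}
    (h𝔭 : (p : 𝓞 K) ∈ 𝔭.asIdeal) (hgood : (W.baseChange K).HasGoodReductionAt 𝔭)
    {n : ℤ} {v : ℕ} (hpn : ¬ (p : ℤ) ∣ n) (hn : W.c₄ = n * (-(p : ℚ)) ^ v) :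
    ∃ t : ResidueField (𝔭.adicCompletionIntegers K), t ≠ 0 ∧
      ((W.baseChange K).reductionAt 𝔭).c₄ = t ^ 4 * (n : ResidueField (𝔭.adicCompletionIntegers K)) := by
  haveI : (W.baseChange K).IsElliptic := by rw [baseChange]; infer_instance
  obtain ⟨𝔭₀, -, huniq, hN⟩ := exists_prime_over_prime p K
  have h𝔭₀ : 𝔭 = 𝔭₀ := by
    have : 𝔭 ∈ ({𝔭₀} : Set (HeightOneSpectrum (𝓞 K))) := by rw [← huniq]; exact_mod_cast h𝔭
    exact this
  subst h𝔭₀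
  have hc₄ := reductionAt_c₄_ne_zero_of_valuation_j_sub_lt_one (W.baseChange K) 𝔭 hp.out hp5 hN hgood
    (valuation_j_sub_lt_one_of_semistabilityIndex_eq_four W p hp5 he h𝔭 hgood)
  have hζ := IsCyclotomicExtension.zeta_spec p ℚ K
  obtain ⟨-, η, hη, hres⟩ := exists_zeta_sub_one_pow_eq_neg_mul_residue_eq_one p hζ 𝔭 h𝔭
  have hfacK : (η : K) ^ v * (W.baseChange K).c₄ =
      (((hζ.toInteger : K) - 1) ^ ((p - 1) / 4 * v)) ^ 4 * (n : K) := by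
    rw [baseChange, map_c₄, hn, map_mul, map_intCast, map_pow, map_neg, map_natCast]
    exact neg_p_pow_mul_eq p hζ hη h4 n v
  have hfac := algebraMap_pow_mul_eq_of_eq 𝔭 hfacK
  have hres' : residue (𝔭.adicCompletionIntegers K)
      ((algebraMap (𝓞 K) (𝔭.adicCompletionIntegers K) η) ^ v) = 1 := by rw [map_pow, hres, one_pow]
  have hn0 : residue (𝔭.adicCompletionIntegers K) (n : 𝔭.adicCompletionIntegers K) ≠ 0 := by
    rw [map_intCast]; exact intCast_residueField_ne_zero p 𝔭 hN hpn
  obtain ⟨t, ht0, ht⟩ :=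
    exists_reductionAt_c₄_eq_pow_four_mul (W.baseChange K) 𝔭 hgood hc₄ hres' hn0 hfac
  exact ⟨t, ht0, by rw [ht, map_intCast]⟩

/-- **THE EXPLICIT SPECIAL FIBRE ON DEFECT `3`/`6` (gen 34's LAW 4, `j̃ = 0` half).** Let `W` be a
globally minimal model of `E/ℚ`, `p ≥ 5` with `3 ∣ p − 1`, `3 ∣ e_E(p)` (Kodaira `II`, `IV`, `IV*`,
`II*`), `K` a `p`-th cyclotomic field and `𝔭 ∋ p` a place of `K` at which `E_K` has good reduction.
If `c₆(E) = n·(−p)^v` with `p ∤ n` (`v = v_p(c₆) ∈ {1, 2, 4, 5}`, `n = c₆/(−p)^v ∈ ℤ`), then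
**`c₆(Ẽ_𝔭) = t⁶·n̄` for some `t ∈ k_𝔭 = 𝔽_p`, `t ≠ 0`**: the special fibre is `y² = x³ − 54n·τ⁶` over
`𝔽_p`, i.e. LAW 4's `β = −54c₆/(−p)^{v_p(c₆)}` up to sixth powers (census 334/334).
[cite: SilvermanAEC2009, Prop. VII.1.3(b), p. 186] -/
theorem exists_reductionAt_c₆_eq_pow_six_mul_intCast_of_three_dvd_semistabilityIndex (hp5 : 5 ≤ p)
    (h3 : 3 ∣ p - 1) (h3e : 3 ∣ semistabilityIndex W p) {𝔭 : HeightOneSpectrum (𝓞 K)}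
    (h𝔭 : (p : 𝓞 K) ∈ 𝔭.asIdeal) (hgood : (W.baseChange K).HasGoodReductionAt 𝔭)
    {n : ℤ} {v : ℕ} (hpn : ¬ (p : ℤ) ∣ n) (hn : W.c₆ = n * (-(p : ℚ)) ^ v) :
    ∃ t : ResidueField (𝔭.adicCompletionIntegers K), t ≠ 0 ∧
      ((W.baseChange K).reductionAt 𝔭).c₆ = t ^ 6 * (n : ResidueField (𝔭.adicCompletionIntegers K)) := by
  haveI : (W.baseChange K).IsElliptic := by rw [baseChange]; infer_instance
  obtain ⟨𝔭₀, -, huniq, hN⟩ := exists_prime_over_prime p K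
  have h𝔭₀ : 𝔭 = 𝔭₀ := by
    have : 𝔭 ∈ ({𝔭₀} : Set (HeightOneSpectrum (𝓞 K))) := by rw [← huniq]; exact_mod_cast h𝔭
    exact this
  subst h𝔭₀
  have hc₆ := reductionAt_c₆_ne_zero_of_valuation_j_lt_one (W.baseChange K) 𝔭 hp.out hp5 hN hgood
    (valuation_j_lt_one_of_three_dvd_semistabilityIndex W p h3e h𝔭 hgood)
  have hζ := IsCyclotomicExtension.zeta_spec p ℚ K
  obtain ⟨-, η, hη, hres⟩ := exists_zeta_sub_one_pow_eq_neg_mul_residue_eq_one p hζ 𝔭 h𝔭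
  have h6 : 6 ∣ p - 1 := by
    have h2 : 2 ∣ p - 1 := by
      rcases hp.out.eq_two_or_odd with h | h
      · omega
      · omega
    have := Nat.Coprime.mul_dvd_of_dvd_of_dvd (by norm_num : Nat.Coprime 2 3) h2 h3
    simpa using this
  have hfacK : (η : K) ^ v * (W.baseChange K).c₆ =
      (((hζ.toInteger : K) - 1) ^ ((p - 1) / 6 * v)) ^ 6 * (n : K) := by
    rw [baseChange, map_c₆, hn, map_mul, map_intCast, map_pow, map_neg, map_natCast]
    exact neg_p_pow_mul_eq p hζ hη h6 n v
  have hfac := algebraMap_pow_mul_eq_of_eq 𝔭 hfacK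
  have hres' : residue (𝔭.adicCompletionIntegers K)
      ((algebraMap (𝓞 K) (𝔭.adicCompletionIntegers K) η) ^ v) = 1 := by rw [map_pow, hres, one_pow]
  have hn0 : residue (𝔭.adicCompletionIntegers K) (n : 𝔭.adicCompletionIntegers K) ≠ 0 := by
    rw [map_intCast]; exact intCast_residueField_ne_zero p 𝔭 hN hpn
  obtain ⟨t, ht0, ht⟩ :=
    exists_reductionAt_c₆_eq_pow_six_mul (W.baseChange K) 𝔭 hgood hc₆ hres' hn0 hfac
  exact ⟨t, ht0, by rw [ht, map_intCast]⟩

end Cyclotomic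

/-! ### The hypothesis `c₄ = n·(−p)^v` / `c₆ = n·(−p)^v` is met, with `v = v_p(Δ_min)/3` / `v_p(Δ_min)/2` -/

section Valuation

variable (W : WeierstrassCurve ℚ) [W.IsElliptic] [W.IsGloballyMinimal] (p : ℕ) [hp : Fact p.Prime]

omit hp in
/-- An integer `m ≠ 0` is `n·(−p)^{v_p(m)}` with `p ∤ n`. [folklore] -/
theorem exists_intCast_eq_mul_neg_pow_padicValInt (hp' : p.Prime) {m : ℤ} (hm : m ≠ 0) :
    ∃ n : ℤ, ¬ (p : ℤ) ∣ n ∧ (m : ℚ) = n * (-(p : ℚ)) ^ padicValInt p m := by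
  haveI : Fact p.Prime := ⟨hp'⟩
  obtain ⟨a, ha⟩ : (p : ℤ) ^ padicValInt p m ∣ m := padicValInt_dvd m
  have hpa : ¬ (p : ℤ) ∣ a := by
    intro hdvd
    have h : (p : ℤ) ^ (padicValInt p m + 1) ∣ (p : ℤ) ^ padicValInt p m * a := by
      rw [pow_succ]; exact mul_dvd_mul_left _ hdvd
    rw [← ha, padicValInt_dvd_iff _ m] at h
    rcases h with h | h
    · exact hm h
    · omega
  refine ⟨(-1) ^ padicValInt p m * a, fun h ↦ hpa ?_, ?_⟩
  · exact ((isUnit_neg_one.pow _).dvd_mul_left).mp h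
  · have h1 : ((-1 : ℚ) ^ padicValInt p m) * ((-1 : ℚ) ^ padicValInt p m) = 1 := by
      rw [← pow_add, ← two_mul, pow_mul]; norm_num
    conv_lhs => rw [ha]
    push_cast
    rw [neg_eq_neg_one_mul, mul_pow]
    linear_combination (-((p : ℚ) ^ padicValInt p m * (a : ℚ))) * h1

omit [W.IsElliptic] hp in
/-- `v_p(1728·x) = v_p(x)` for `p ≥ 5`. [folklore] -/
theorem padicValRat_1728_mul_eq (hp' : p.Prime) (hp5 : 5 ≤ p) (x : ℚ) (hx : x ≠ 0) :
    padicValRat p (1728 * x) = padicValRat p x := by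
  haveI : Fact p.Prime := ⟨hp'⟩
  have h1728 : padicValRat p (1728 : ℚ) = 0 := by
    rw [show (1728 : ℚ) = ((1728 : ℕ) : ℚ) by norm_num, padicValRat.of_nat, Nat.cast_eq_zero,
      padicValNat.eq_zero_of_not_dvd]
    intro h
    have h6 : p ∣ 2 ^ 6 * 3 ^ 3 := by norm_num at h ⊢; exact h
    rcases (Nat.Prime.dvd_mul hp').mp h6 with h' | h'
    · have := (Nat.prime_dvd_prime_iff_eq hp' Nat.prime_two).mp (hp'.dvd_of_dvd_pow h'); omega
    · have := (Nat.prime_dvd_prime_iff_eq hp' Nat.prime_three).mp (hp'.dvd_of_dvd_pow h'); omega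
  rw [padicValRat.mul (by norm_num) hx, h1728, zero_add]

/-- **Defect `4`: `3·v_p(c₄) = v_p(Δ_min)`** (Kodaira `III`: `v_p(c₄) = 1`, `v_p(Δ) = 3`; `III*`:
`v_p(c₄) = 3`, `v_p(Δ) = 9`), for `W` globally minimal with `e_E(p) = 4`, `p ≥ 5`, and potentially
good reduction (`ord_p j ≥ 0`, read off a good place upstairs): `2 ∤ v_p(Δ)` rules out
`2·v_p(c₆) = v_p(Δ)`, so the `c₄³`-term carries the valuation in `1728Δ = c₄³ − c₆²`.
[cite: SilvermanATAEC1994, IV Table 4.1 (PDF p. 365)] -/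
theorem three_mul_padicValInt_c₄_eq_of_semistabilityIndex_eq_four (hp5 : 5 ≤ p)
    (he : semistabilityIndex W p = 4) (hj : 0 ≤ padicValRat p W.j) :
    W.c₄ ≠ 0 ∧ 3 * padicValRat p W.c₄ = padicValInt p W.minimalDiscriminantInt := by
  have h2v : ¬ 2 ∣ padicValInt p W.minimalDiscriminantInt := by
    intro h
    have h46 : 4 ∣ 6 := he ▸ semistabilityIndex_dvd_six_of_two_dvd W p h
    omega
  have hΔ0 : W.Δ ≠ 0 := W.isUnit_Δ.ne_zero
  have hΔv := padicValRat_Δ_eq W p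
  have hc4 : W.c₄ ≠ 0 := by
    intro h0
    -- `c₄ = 0` ⟹ `c₆² = −1728Δ` ⟹ `2 v(c₆) = v(Δ)`
    have hrel : W.c₆ ^ 2 = -(1728 * W.Δ) := by
      have := W.c_relation; rw [h0, zero_pow three_ne_zero] at this; linear_combination this
    have hc6 : W.c₆ ≠ 0 := by
      intro h; rw [h, zero_pow two_ne_zero] at hrel
      exact (neg_ne_zero.mpr (mul_ne_zero (by norm_num) hΔ0)) hrel.symm
    have h := congrArg (padicValRat p) hrel
    rw [padicValRat.pow, padicValRat.neg, padicValRat_1728_mul_eq p hp.out hp5 _ hΔ0, hΔv] at h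
    exact h2v (Int.natCast_dvd_natCast.mp ⟨padicValRat p W.c₆, by exact_mod_cast h.symm⟩)
  refine ⟨hc4, ?_⟩
  have hjdef : W.j = W.c₄ ^ 3 / W.Δ := by
    rw [WeierstrassCurve.j, ← coe_Δ', div_eq_inv_mul, Units.val_inv_eq_inv_val]
  have hvj : padicValRat p W.j = 3 * padicValRat p W.c₄ - padicValRat p W.Δ := by
    rw [hjdef, padicValRat.div (pow_ne_zero 3 hc4) hΔ0, padicValRat.pow]; push_cast; ring
  rcases (show padicValRat p W.Δ ≤ 3 * padicValRat p W.c₄ by linarith).eq_or_lt with h | hlt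
  · rw [← hΔv, h]
  · exfalso
    -- `3 v(c₄) > v(Δ)`: then `c₆² = c₄³ − 1728Δ` has valuation `v(Δ)`, even — contradiction
    have hrel : W.c₆ ^ 2 = -(1728 * W.Δ) + W.c₄ ^ 3 := by
      have := W.c_relation; linear_combination this
    have hv3 : padicValRat p (W.c₄ ^ 3) = 3 * padicValRat p W.c₄ := by rw [padicValRat.pow]; rfl
    have hvn : padicValRat p (-(1728 * W.Δ)) = padicValRat p W.Δ := by
      rw [padicValRat.neg, padicValRat_1728_mul_eq p hp.out hp5 _ hΔ0]
    have hne : -(1728 * W.Δ) + W.c₄ ^ 3 ≠ 0 := by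
      intro h0
      have h1 : W.c₄ ^ 3 = 1728 * W.Δ := by linear_combination h0
      have h2 := congrArg (padicValRat p) h1
      rw [hv3, padicValRat_1728_mul_eq p hp.out hp5 _ hΔ0] at h2
      exact hlt.ne h2.symm
    have hsum : padicValRat p (-(1728 * W.Δ) + W.c₄ ^ 3) = padicValRat p W.Δ := by
      rw [padicValRat.add_eq_of_lt hne (neg_ne_zero.mpr (mul_ne_zero (by norm_num) hΔ0))
        (pow_ne_zero 3 hc4) (by rw [hvn, hv3]; exact hlt), hvn]
    have hc6 : W.c₆ ≠ 0 := by
      intro h; rw [h, zero_pow two_ne_zero] at hrel; exact hne hrel.symm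
    have h := congrArg (padicValRat p) hrel
    rw [padicValRat.pow, hsum, hΔv] at h
    exact h2v (Int.natCast_dvd_natCast.mp ⟨padicValRat p W.c₆, by exact_mod_cast h.symm⟩)

/-- **Defect `3`/`6`: `2·v_p(c₆) = v_p(Δ_min)`** (Kodaira `II`: `(1, 2)`, `IV`: `(2, 4)`, `IV*`:
`(4, 8)`, `II*`: `(5, 10)`), for `W` globally minimal with `3 ∣ e_E(p)`, `p ≥ 5`, `ord_p j ≥ 0`:
`3 ∤ v_p(Δ)` rules out `3·v_p(c₄) = v_p(Δ)`, so the `c₆²`-term carries the valuation.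
[cite: SilvermanATAEC1994, IV Table 4.1 (PDF p. 365)] -/
theorem two_mul_padicValInt_c₆_eq_of_three_dvd_semistabilityIndex (hp5 : 5 ≤ p)
    (h3e : 3 ∣ semistabilityIndex W p) (hj : 0 ≤ padicValRat p W.j) :
    W.c₆ ≠ 0 ∧ 2 * padicValRat p W.c₆ = padicValInt p W.minimalDiscriminantInt := by
  have h3v : ¬ 3 ∣ padicValInt p W.minimalDiscriminantInt := by
    intro h
    have h34 : 3 ∣ 4 := h3e.trans (semistabilityIndex_dvd_four_of_three_dvd W p h)
    omega
  have hΔ0 : W.Δ ≠ 0 := W.isUnit_Δ.ne_zero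
  have hΔv := padicValRat_Δ_eq W p
  have hrel : W.c₆ ^ 2 = -(1728 * W.Δ) + W.c₄ ^ 3 := by
    have := W.c_relation; linear_combination this
  have hvn : padicValRat p (-(1728 * W.Δ)) = padicValRat p W.Δ := by
    rw [padicValRat.neg, padicValRat_1728_mul_eq p hp.out hp5 _ hΔ0]
  -- valuation of `c₄³ − 1728Δ` is `v(Δ)`
  have hsum : -(1728 * W.Δ) + W.c₄ ^ 3 ≠ 0 ∧
      padicValRat p (-(1728 * W.Δ) + W.c₄ ^ 3) = padicValRat p W.Δ := by
    by_cases hc4 : W.c₄ = 0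
    · rw [hc4, zero_pow three_ne_zero, add_zero]
      exact ⟨neg_ne_zero.mpr (mul_ne_zero (by norm_num) hΔ0), hvn⟩
    have hjdef : W.j = W.c₄ ^ 3 / W.Δ := by
      rw [WeierstrassCurve.j, ← coe_Δ', div_eq_inv_mul, Units.val_inv_eq_inv_val]
    have hvj : padicValRat p W.j = 3 * padicValRat p W.c₄ - padicValRat p W.Δ := by
      rw [hjdef, padicValRat.div (pow_ne_zero 3 hc4) hΔ0, padicValRat.pow]; push_cast; ring
    have hv3 : padicValRat p (W.c₄ ^ 3) = 3 * padicValRat p W.c₄ := by rw [padicValRat.pow]; rfl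
    have hlt : padicValRat p W.Δ < 3 * padicValRat p W.c₄ := by
      rcases (show padicValRat p W.Δ ≤ 3 * padicValRat p W.c₄ by linarith).eq_or_lt with h | h
      · exfalso; apply h3v
        rw [hΔv] at h
        exact Int.natCast_dvd_natCast.mp ⟨padicValRat p W.c₄, by exact_mod_cast h⟩
      · exact h
    have hne : -(1728 * W.Δ) + W.c₄ ^ 3 ≠ 0 := by
      intro h0
      have h1 : W.c₄ ^ 3 = 1728 * W.Δ := by linear_combination h0
      have h2 := congrArg (padicValRat p) h1
      rw [hv3, padicValRat_1728_mul_eq p hp.out hp5 _ hΔ0] at h2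
      exact hlt.ne h2.symm
    refine ⟨hne, ?_⟩
    rw [padicValRat.add_eq_of_lt hne (neg_ne_zero.mpr (mul_ne_zero (by norm_num) hΔ0))
      (pow_ne_zero 3 hc4) (by rw [hvn, hv3]; exact hlt), hvn]
  have hc6 : W.c₆ ≠ 0 := by
    intro h; rw [h, zero_pow two_ne_zero] at hrel; exact hsum.1 hrel.symm
  refine ⟨hc6, ?_⟩
  have h := congrArg (padicValRat p) hrel
  rw [padicValRat.pow, hsum.2, hΔv] at h
  exact_mod_cast h

/-- **On defect `4`, `c₄(E) = n·(−p)^{v_p(c₄)}` with `p ∤ n` and `3·v_p(c₄) = v_p(Δ_min)`** — the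
hypothesis of `exists_reductionAt_c₄_eq_pow_four_mul_intCast_of_semistabilityIndex_eq_four` is met,
with Cremona's integers (`W` globally minimal, `e_E(p) = 4`, `p ≥ 5`, a good place above `p` in some
number field). [cite: SilvermanATAEC1994, IV Table 4.1 (PDF p. 365)] -/
theorem exists_c₄_eq_mul_neg_pow_of_semistabilityIndex_eq_four (hp5 : 5 ≤ p)
    (he : semistabilityIndex W p = 4) {F : Type*} [Field F] [NumberField F]
    {w : HeightOneSpectrum (𝓞 F)} (hw : (p : 𝓞 F) ∈ w.asIdeal)
    (hgood : (W.baseChange F).HasGoodReductionAt w) :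
    ∃ n : ℤ, ¬ (p : ℤ) ∣ n ∧
      W.c₄ = n * (-(p : ℚ)) ^ padicValInt p (integralModelInt W).c₄ ∧
      3 * padicValInt p (integralModelInt W).c₄ = padicValInt p W.minimalDiscriminantInt := by
  have hj : 0 ≤ padicValRat p W.j := padicValRat_j_nonneg_of_hasGoodReductionAt_baseChange W p hw hgood
  obtain ⟨hc4, h3⟩ := three_mul_padicValInt_c₄_eq_of_semistabilityIndex_eq_four W p hp5 he hj
  have hcast : W.c₄ = ((integralModelInt W).c₄ : ℚ) := by
    have h := (integralModelInt W).map_c₄ (Int.castRingHom ℚ)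
    rw [map_integralModelInt, eq_intCast] at h
    exact h
  have hm : (integralModelInt W).c₄ ≠ 0 := by
    intro h; rw [h, Int.cast_zero] at hcast; exact hc4 hcast
  obtain ⟨n, hpn, hn⟩ := exists_intCast_eq_mul_neg_pow_padicValInt p hp.out hm
  refine ⟨n, hpn, by rw [hcast, hn], ?_⟩
  rw [hcast, padicValRat.of_int] at h3
  exact_mod_cast h3

/-- **On defect `3`/`6`, `c₆(E) = n·(−p)^{v_p(c₆)}` with `p ∤ n` and `2·v_p(c₆) = v_p(Δ_min)`** — the
hypothesis of `exists_reductionAt_c₆_eq_pow_six_mul_intCast_of_three_dvd_semistabilityIndex` is met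
(`W` globally minimal, `3 ∣ e_E(p)`, `p ≥ 5`, a good place above `p` in some number field).
[cite: SilvermanATAEC1994, IV Table 4.1 (PDF p. 365)] -/
theorem exists_c₆_eq_mul_neg_pow_of_three_dvd_semistabilityIndex (hp5 : 5 ≤ p)
    (h3e : 3 ∣ semistabilityIndex W p) {F : Type*} [Field F] [NumberField F]
    {w : HeightOneSpectrum (𝓞 F)} (hw : (p : 𝓞 F) ∈ w.asIdeal)
    (hgood : (W.baseChange F).HasGoodReductionAt w) :
    ∃ n : ℤ, ¬ (p : ℤ) ∣ n ∧
      W.c₆ = n * (-(p : ℚ)) ^ padicValInt p (integralModelInt W).c₆ ∧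
      2 * padicValInt p (integralModelInt W).c₆ = padicValInt p W.minimalDiscriminantInt := by
  have hj : 0 ≤ padicValRat p W.j := padicValRat_j_nonneg_of_hasGoodReductionAt_baseChange W p hw hgood
  obtain ⟨hc6, h2⟩ := two_mul_padicValInt_c₆_eq_of_three_dvd_semistabilityIndex W p hp5 h3e hj
  have hcast : W.c₆ = ((integralModelInt W).c₆ : ℚ) := by
    have h := (integralModelInt W).map_c₆ (Int.castRingHom ℚ)
    rw [map_integralModelInt, eq_intCast] at h
    exact h
  have hm : (integralModelInt W).c₆ ≠ 0 := by
    intro h; rw [h, Int.cast_zero] at hcast; exact hc6 hcast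
  obtain ⟨n, hpn, hn⟩ := exists_intCast_eq_mul_neg_pow_padicValInt p hp.out hm
  refine ⟨n, hpn, by rw [hcast, hn], ?_⟩
  rw [hcast, padicValRat.of_int] at h2
  exact_mod_cast h2

end Valuation

end Summit.BirchSwinnertonDyer.Rank1Residual.Additive

end
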